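import Summits.ResolutionOfSingularities.ResolutionOfSingularities.Theses.QuotientModels
import Summits.ResolutionOfSingularities.ResolutionOfSingularities.Theorems.RadicandHessianClasses
import Literature.AlgebraicGeometry.Resolution.ProperModelsPatchingOfResolution
import Literature.AlgebraicGeometry.Resolution.ResolutionOfSingularities
import HarnessLib

/-!
# QuotientModelsHessianLadder — by-name kernels of the decomp-res node «HessianLadder» (phase 3 of the filing)

Cell decomp-res, lens-1 g5 node HessianLadder rev 2 (CRITIC-LEDGER row 35 OBJECTION accepted → row 37 CLEARED AS CHILD
NODE of `QuotientModels`
refining BY NAME its aside `QuotientModels.SimpleRadicialRegModelDimFour`, item stmt-27201, SRM₄).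
Phase 1 = `Theorems/RadicandHessianClasses.lean` (pointwise levels, presentations, classes; p763089); phase 2 = the four
ASIDES on route QuotientModels (rev 4, commit a87fc2b27819): `TameRadicands` (stmt-28911, KNOWN-MOD-PORT),
`HyperbolicRadicands` (stmt-28912, UNDECIDED(T-hyp-descent), small-seam flag), `RankOneRadicands` (stmt-28913,
UNDECIDED),
`DegenerateRadicands` (stmt-28914, declared residual).  THIS FILE proves, against those decls BY NAME (0 sorry; proofs
verbatim from HOME/decomp-res-lens-1/g5/HessianLadder.lean rev 2 sha256 d5221834…, critic's own `lean check` rc 0):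

* `closes` — Tame → Hyperbolic → RankOne → Degenerate → SRM₄ (classical case split on the class of the instance);
* `srm4_iff` — **EXACT 4-way kernel** SRM₄ ⟺ Tame ∧ Hyperbolic ∧ RankOne ∧ Degenerate (nothing lost, nothing smuggled),
  with the four restriction lemmas `…_of_srm4`;
* `srm4_of_root`, `pieces_of_root` — necessity from `_root_.ResolutionOfSingularities` (resolve any model of K);
* `TameRadicandsCore` + `tameRadicands_of_core` — piece 0 = the named fact `CossartPiltant2019` (dim ≤ 3, used as a
  hypothesis) + its genuine dimension-four port content (the tame class);
* cumulative rungs `HyperbolicRadicandsCumulative`, `RankOneRadicandsCumulative` with `…_iff` and `srm4_iff_cumulative`.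

Instrument: HOME/decomp-res-lens-1/g5/hessian/T-hessian-0.md (+ §T-hessian-1).  Census data of the cell cited by the
node: HOME/census/COSTUME-CENSUS-v5.1 (json sha256 536c7ecd…).  [CossartPiltant2019; Kato1994; hauser2024 p.2]
-/

namespace Summit.ResolutionOfSingularities.ResolutionOfSingularities.Theorems.QuotientModelsHessianLadder

open AlgebraicGeometry Literature.AlgebraicGeometry.Resolution
open Summit.ResolutionOfSingularities.ResolutionOfSingularities.Theses
open Summit.ResolutionOfSingularities.ResolutionOfSingularities.Theorems.RadicandHessianClasses

/-! ## The deciding theorem of the node (child form, by name) -/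

/-- **closes** — the four rungs give SRM₄ = `QuotientModels.SimpleRadicialRegModelDimFour`
(item 27201) by the classical case split on the class of the instance. -/
theorem closes (h₀ : QuotientModels.TameRadicands) (h₁ : QuotientModels.HyperbolicRadicands)
    (h₂ : QuotientModels.RankOneRadicands) (h₃ : QuotientModels.DegenerateRadicands) :
    QuotientModels.SimpleRadicialRegModelDimFour := by
  intro p hp k _ _ L K _ _ _ _ _ _ a ha htop hN M hM
  by_cases c₀ : topologicalKrullDim M.X ≤ 3 ∨ TameClass p k L K
  · exact h₀ p hp k L K a ha htop hN M hM c₀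
  by_cases c₁ : HyperbolicClass p k L K
  · exact h₁ p hp k L K a ha htop hN M hM c₀ c₁
  have c₁' : ¬ (topologicalKrullDim M.X ≤ 3 ∨ HyperbolicClass p k L K) := by
    rintro (hdim | hcl)
    · exact c₀ (Or.inl hdim)
    · exact c₁ hcl
  by_cases c₂ : RankOneClass p k L K
  · exact h₂ p hp k L K a ha htop hN M hM c₁' c₂
  · exact h₃ p hp k L K a ha htop hN M hM c₁' c₂

/-! ## Kernels: the split is exact, and every piece is summit-implied -/

/-- Each rung is a restriction of SRM₄. -/
theorem tameRadicands_of_srm4 (h : QuotientModels.SimpleRadicialRegModelDimFour) :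
    QuotientModels.TameRadicands :=
  fun p hp k _ _ L K _ _ _ _ _ _ a ha htop hN M hM _ => h p hp k L K a ha htop hN M hM

/-- Each rung is a restriction of SRM₄. -/
theorem hyperbolicRadicands_of_srm4 (h : QuotientModels.SimpleRadicialRegModelDimFour) :
    QuotientModels.HyperbolicRadicands :=
  fun p hp k _ _ L K _ _ _ _ _ _ a ha htop hN M hM _ _ => h p hp k L K a ha htop hN M hM

/-- Each rung is a restriction of SRM₄. -/
theorem rankOneRadicands_of_srm4 (h : QuotientModels.SimpleRadicialRegModelDimFour) :
    QuotientModels.RankOneRadicands :=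
  fun p hp k _ _ L K _ _ _ _ _ _ a ha htop hN M hM _ _ => h p hp k L K a ha htop hN M hM

/-- Each rung is a restriction of SRM₄. -/
theorem degenerateRadicands_of_srm4 (h : QuotientModels.SimpleRadicialRegModelDimFour) :
    QuotientModels.DegenerateRadicands :=
  fun p hp k _ _ L K _ _ _ _ _ _ a ha htop hN M hM _ _ => h p hp k L K a ha htop hN M hM

/-- **Exact kernel**: SRM₄ ⟺ the conjunction of the four rungs (nothing lost, nothing smuggled). -/
theorem srm4_iff :
    QuotientModels.SimpleRadicialRegModelDimFour ↔
      QuotientModels.TameRadicands ∧ QuotientModels.HyperbolicRadicands ∧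
        QuotientModels.RankOneRadicands ∧ QuotientModels.DegenerateRadicands :=
  ⟨fun h => ⟨tameRadicands_of_srm4 h, hyperbolicRadicands_of_srm4 h, rankOneRadicands_of_srm4 h,
    degenerateRadicands_of_srm4 h⟩, fun h => closes h.1 h.2.1 h.2.2.1 h.2.2.2⟩

/-- **Necessity from the root**: the summit implies SRM₄ (resolve any model of `K`). -/
theorem srm4_of_root (h : _root_.ResolutionOfSingularities) :
    QuotientModels.SimpleRadicialRegModelDimFour := by
  intro p hp k _ _ L K _ _ _ _ _ _ a _ _ _ M _
  have hres : Scheme.HasResolution M.X :=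
    _root_.ResolutionOfSingularities_iff.mp h p hp k M.X M.π inferInstance inferInstance
      inferInstance inferInstance
  obtain ⟨M', -, hM'⟩ := M.exists_hom_isRegular_of_hasResolution hres
  exact ⟨M', hM'⟩

/-- Every piece is summit-implied (no piece is stronger than the root). -/
theorem pieces_of_root (h : _root_.ResolutionOfSingularities) :
    QuotientModels.TameRadicands ∧ QuotientModels.HyperbolicRadicands ∧
      QuotientModels.RankOneRadicands ∧ QuotientModels.DegenerateRadicands :=
  srm4_iff.mp (srm4_of_root h)

/-! ## Partial kernel: the low-dimensional disjunct of piece 0 is Cossart–Piltant 2019 -/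

/-- The genuine port content of piece 0: the tame class in dimension four. -/
@[conjecture] def TameRadicandsCore : Prop :=
  ∀ p : ℕ, p.Prime → ∀ (k : Type) [Field k] [CharP k p] (L K : Type) [Field L] [Field K]
    [Algebra k L] [Algebra k K] [Algebra L K] [IsScalarTower k L K] (a : K),
    a ^ p ∈ (algebraMap L K).range → IntermediateField.adjoin L ({a} : Set K) = ⊤ →
    (∃ N : ProperModel.{0} k L, Scheme.IsRegular N.X) →
    ∀ M : ProperModel.{0} k K, topologicalKrullDim M.X ≤ 4 → TameClass p k L K →
      ∃ M' : ProperModel.{0} k K, Scheme.IsRegular M'.X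

/-- Models of dimension `≤ 3` are dominated by regular ones, by the named fact
`CossartPiltant2019` (unproved Literature fact used as a hypothesis). -/
theorem regularModel_of_dim_le_three (hCP : CossartPiltant2019.{0}) {k K : Type} [Field k]
    [Field K] [Algebra k K] (M : ProperModel.{0} k K) (hM : topologicalKrullDim M.X ≤ 3) :
    ∃ M' : ProperModel.{0} k K, Scheme.IsRegular M'.X := by
  have hres : Scheme.HasResolution M.X :=
    hCP k M.X M.π inferInstance inferInstance inferInstance inferInstance hM
  obtain ⟨M', -, hM'⟩ := M.exists_hom_isRegular_of_hasResolution hres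
  exact ⟨M', hM'⟩

/-- Piece 0 = Cossart–Piltant 2019 + its dimension-four core. -/
theorem tameRadicands_of_core (hCP : CossartPiltant2019.{0}) (hcore : TameRadicandsCore) :
    QuotientModels.TameRadicands := by
  intro p hp k _ _ L K _ _ _ _ _ _ a ha htop hN M hM hc
  rcases hc with hdim | hcl
  · exact regularModel_of_dim_le_three hCP M hdim
  · exact hcore p hp k L K a ha htop hN M hM hcl

/-- The cumulative first rung (pieces 0 and 1 together): SRM₄ on the whole hyperbolic class. -/
@[conjecture] def HyperbolicRadicandsCumulative : Prop :=
  ∀ p : ℕ, p.Prime → ∀ (k : Type) [Field k] [CharP k p] (L K : Type) [Field L] [Field K]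
    [Algebra k L] [Algebra k K] [Algebra L K] [IsScalarTower k L K] (a : K),
    a ^ p ∈ (algebraMap L K).range → IntermediateField.adjoin L ({a} : Set K) = ⊤ →
    (∃ N : ProperModel.{0} k L, Scheme.IsRegular N.X) →
    ∀ M : ProperModel.{0} k K, topologicalKrullDim M.X ≤ 4 →
      (topologicalKrullDim M.X ≤ 3 ∨ HyperbolicClass p k L K) →
      ∃ M' : ProperModel.{0} k K, Scheme.IsRegular M'.X

/-- Ladder monotonicity: the cumulative first rung is exactly pieces 0 ∧ 1. -/
theorem hyperbolicRadicandsCumulative_iff :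
    HyperbolicRadicandsCumulative ↔ QuotientModels.TameRadicands ∧ QuotientModels.HyperbolicRadicands := by
  constructor
  · intro h
    refine ⟨?_, ?_⟩
    · intro p hp k _ _ L K _ _ _ _ _ _ a ha htop hN M hM hc
      refine h p hp k L K a ha htop hN M hM ?_
      rcases hc with hdim | hcl
      · exact Or.inl hdim
      · exact Or.inr (hyperbolicClass_of_tameClass hcl)
    · intro p hp k _ _ L K _ _ _ _ _ _ a ha htop hN M hM _ hc
      exact h p hp k L K a ha htop hN M hM (Or.inr hc)
  · rintro ⟨h₀, h₁⟩ p hp k _ _ L K _ _ _ _ _ _ a ha htop hN M hM hc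
    by_cases c₀ : topologicalKrullDim M.X ≤ 3 ∨ TameClass p k L K
    · exact h₀ p hp k L K a ha htop hN M hM c₀
    · rcases hc with hdim | hcl
      · exact absurd (Or.inl hdim) c₀
      · exact h₁ p hp k L K a ha htop hN M hM c₀ hcl

/-- The cumulative second rung (pieces 0, 1 and 2 together): SRM₄ on the whole rank-one class. -/
@[conjecture] def RankOneRadicandsCumulative : Prop :=
  ∀ p : ℕ, p.Prime → ∀ (k : Type) [Field k] [CharP k p] (L K : Type) [Field L] [Field K]
    [Algebra k L] [Algebra k K] [Algebra L K] [IsScalarTower k L K] (a : K),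
    a ^ p ∈ (algebraMap L K).range → IntermediateField.adjoin L ({a} : Set K) = ⊤ →
    (∃ N : ProperModel.{0} k L, Scheme.IsRegular N.X) →
    ∀ M : ProperModel.{0} k K, topologicalKrullDim M.X ≤ 4 →
      (topologicalKrullDim M.X ≤ 3 ∨ RankOneClass p k L K) →
      ∃ M' : ProperModel.{0} k K, Scheme.IsRegular M'.X

/-- Ladder monotonicity: the cumulative second rung is exactly (pieces 0 ∧ 1) ∧ piece 2. -/
theorem rankOneRadicandsCumulative_iff :
    RankOneRadicandsCumulative ↔ HyperbolicRadicandsCumulative ∧ QuotientModels.RankOneRadicands := by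
  constructor
  · intro h
    refine ⟨?_, ?_⟩
    · intro p hp k _ _ L K _ _ _ _ _ _ a ha htop hN M hM hc
      refine h p hp k L K a ha htop hN M hM ?_
      rcases hc with hdim | hcl
      · exact Or.inl hdim
      · exact Or.inr (rankOneClass_of_hyperbolicClass hcl)
    · intro p hp k _ _ L K _ _ _ _ _ _ a ha htop hN M hM _ hc
      exact h p hp k L K a ha htop hN M hM (Or.inr hc)
  · rintro ⟨h₁, h₂⟩ p hp k _ _ L K _ _ _ _ _ _ a ha htop hN M hM hc
    by_cases c₁ : topologicalKrullDim M.X ≤ 3 ∨ HyperbolicClass p k L K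
    · exact h₁ p hp k L K a ha htop hN M hM c₁
    · rcases hc with hdim | hcl
      · exact absurd (Or.inl hdim) c₁
      · exact h₂ p hp k L K a ha htop hN M hM c₁ hcl

/-- The ladder read cumulatively: SRM₄ ⟺ (hyperbolic cumulative rung ∧ rank-one rung) ∧ residual. -/
theorem srm4_iff_cumulative :
    QuotientModels.SimpleRadicialRegModelDimFour ↔
      RankOneRadicandsCumulative ∧ QuotientModels.DegenerateRadicands := by
  rw [srm4_iff, rankOneRadicandsCumulative_iff, hyperbolicRadicandsCumulative_iff]
  constructor
  · rintro ⟨h₀, h₁, h₂, h₃⟩; exact ⟨⟨⟨h₀, h₁⟩, h₂⟩, h₃⟩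
  · rintro ⟨⟨⟨h₀, h₁⟩, h₂⟩, h₃⟩; exact ⟨h₀, h₁, h₂, h₃⟩

end Summit.ResolutionOfSingularities.ResolutionOfSingularities.Theorems.QuotientModelsHessianLadder
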